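import Mathlib
import Summits.SmoothPoincare4.SmoothPoincare4.Theorems.CylinderEntropyCylinderRungTwoKCertSoundTab
import HarnessLib

/-!
# Kernel certificate checker for `stub_certMid`, VIII: soundness of the per-atom box enclosures

Infrastructure file for the kernel-clean discharge of the registered stub `stub_certMid` of crux stmt-SmoothPoincare4-7631
(`Summit.SmoothPoincare4.SmoothPoincare4.Theses.CylinderEntropy.CylinderRungTwo`, line `killing-flux`).  On a box
`[u₁, u₂] × [θ̂₁, θ̂₂]`: the zonal factor of an atom lies in `zRange` (monotonicity, tangent minorants, grid-cell lower bounds,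
convexity majorant), `(u - σ)/(2τ)` lies in `kRange`, the Gaussian factor lies in `[min glo, gnear]`; hence `atomBox` /
`atomsBox` bound `Σ w_j G_j Z_j` from below and enclose the two partial derivatives of `R`; and the derivatives of `G`, `Zc`
and `R`.
No named facts.
-/

-- the registered namespace `Summit.SmoothPoincare4.SmoothPoincare4.…` repeats a component
set_option linter.dupNamespace false

noncomputable section

namespace Summit.SmoothPoincare4.SmoothPoincare4.Cruxes.CylinderRungTwo.KillingFlux

namespace KCert

open Set
open Literature.Analysis.ValidatedNumerics.NumericsMP
open Summit.SmoothPoincare4.SmoothPoincare4.Theorems.CylinderEntropySliceIsolation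
open Summit.SmoothPoincare4.SmoothPoincare4.Theorems.CylinderEntropySliceIsolation.Cert

variable (C : KCell)

/-! ### The Gaussian factor -/

/-- The Gaussian factor `G(u) = e^{-(u-σ)²/(4τ)}` of an atom. [folklore] -/
def KAtom.G (a : KAtom) (u : ℝ) : ℝ := Real.exp (-(u - a.σ) ^ 2 / (4 * a.tau))

/-- `0 < G`. [folklore] -/
theorem G_pos (a : KAtom) (u : ℝ) : 0 < a.G u := Real.exp_pos _

/-- `G ≤ 1`. [folklore] -/
theorem G_le_one {a : KAtom} (ha : atomOK C a = true) (u : ℝ) : a.G u ≤ 1 := by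
  unfold KAtom.G
  rw [Real.exp_le_one_iff, neg_div]
  have := tau_pos C ha
  exact neg_nonpos.2 (by positivity)

/-- Monotonicity of `G` in the distance to `σ`: `|v - σ| ≤ |u - σ|` gives `G u ≤ G v`. [folklore] -/
theorem G_le_of_abs_le {a : KAtom} (ha : atomOK C a = true) {u v : ℝ} (h : |v - (a.σ : ℝ)| ≤ |u - (a.σ : ℝ)|) :
    a.G u ≤ a.G v := by
  unfold KAtom.G
  have hτ := tau_pos C ha
  rw [Real.exp_le_exp, neg_div, neg_div, neg_le_neg_iff]
  refine div_le_div_of_nonneg_right ?_ (by positivity)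
  have := sq_le_sq.2 (show |v - (a.σ : ℝ)| ≤ |u - (a.σ : ℝ)| from h)
  simpa using this

/-- The certified one-sided Gaussian bounds: `expLo(-(u-σ)²/(4 tlo)) ≤ G u ≤ expHi(-(u-σ)²/(4 thi))`. [folklore] -/
theorem G_bounds {a : KAtom} (ha : atomOK C a = true) (u : ℚ) :
    ((expLo (-(u - a.σ) ^ 2 / (4 * a.tlo)) C.prec : ℚ) : ℝ) ≤ a.G u ∧
      a.G u ≤ ((expHi (-(u - a.σ) ^ 2 / (4 * a.thi)) C.prec : ℚ) : ℝ) := by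
  have hτ := tau_pos C ha
  obtain ⟨_, _, _, htlo, htloτ, hτthi, _⟩ := atomOK_sound C ha
  have htlo0 : (0 : ℝ) < a.tlo := by exact_mod_cast htlo
  have hsq : (0 : ℝ) ≤ ((u : ℝ) - a.σ) ^ 2 := sq_nonneg _
  unfold KAtom.G
  constructor
  · refine (expLo_le _ _).trans (Real.exp_le_exp.2 ?_)
    push_cast
    rw [neg_div, neg_div, neg_le_neg_iff]
    exact div_le_div_of_nonneg_left hsq (by positivity) (by linarith)
  · refine le_trans (Real.exp_le_exp.2 ?_) (exp_le_expHi _ _)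
    push_cast
    rw [neg_div, neg_div, neg_le_neg_iff]
    exact div_le_div_of_nonneg_left hsq (by positivity) (by linarith)

/-- `Zc θ = e^{f θ - θ²/(4τ)}`. [folklore] -/
theorem Zc_eq_exp {a : KAtom} (ha : atomOK C a = true) (θ : ℝ) : a.Zc θ = Real.exp (a.f θ - θ ^ 2 / (4 * a.tau)) := by
  rw [← log_Zc_eq, Real.exp_log (Zc_pos C ha θ)]

/-! ### Derivatives -/

/-- `G' = G · (-(u-σ)/(2τ))`. [folklore] -/
theorem hasDerivAt_G {a : KAtom} (ha : atomOK C a = true) (u : ℝ) :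
    HasDerivAt a.G (a.G u * (-(u - a.σ) / (2 * a.tau))) u := by
  have hτ := (tau_pos C ha).ne'
  have hd : HasDerivAt (fun v : ℝ => (v - a.σ) ^ 2) (2 * (u - a.σ)) u := by
    have h := ((hasDerivAt_id u).sub_const (a.σ : ℝ)).pow 2
    have e : ((2 : ℕ) : ℝ) * (id u - (a.σ : ℝ)) ^ (2 - 1) * 1 = 2 * (u - a.σ) := by norm_num [id]
    rw [e] at h
    exact h
  have h1 : HasDerivAt (fun v : ℝ => -(v - a.σ) ^ 2 / (4 * a.tau)) (-(2 * (u - a.σ)) / (4 * a.tau)) u :=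
    hd.neg.div_const _
  unfold KAtom.G
  refine h1.exp.congr_deriv ?_
  field_simp
  ring

/-- `Zc' = Zc · (f' - θ/(2τ))`. [folklore] -/
theorem hasDerivAt_Zc {a : KAtom} (ha : atomOK C a = true) (θ : ℝ) :
    HasDerivAt a.Zc (a.Zc θ * (a.fd θ - θ / (2 * a.tau))) θ := by
  have hτ := (tau_pos C ha).ne'
  have hfun : a.Zc = fun x => Real.exp (a.f x - x ^ 2 / (4 * a.tau)) := by
    funext x; exact Zc_eq_exp C ha x
  have h2 : HasDerivAt (fun x : ℝ => x ^ 2 / (4 * a.tau)) (θ / (2 * a.tau)) θ := by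
    have h := (hasDerivAt_pow 2 θ).div_const (4 * a.tau)
    have e : ((2 : ℕ) : ℝ) * θ ^ (2 - 1) / (4 * a.tau) = θ / (2 * a.tau) := by
      rw [show (2 : ℕ) - 1 = 1 from rfl, pow_one]
      push_cast
      field_simp
      ring
    rw [e] at h
    exact h
  have h3 : HasDerivAt (fun x => a.f x - x ^ 2 / (4 * a.tau)) (a.fd θ - θ / (2 * a.tau)) θ :=
    (hasDerivAt_f C ha θ).sub h2
  have h := h3.exp
  rw [← Zc_eq_exp C ha θ, ← hfun] at h
  exact h

/-! ### The Gaussian factor on a `u`-interval -/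

/-- On `[u₁, u₂]`, `G ≥ min (G u₁) (G u₂)`. [folklore] -/
theorem G_ge_min {a : KAtom} (ha : atomOK C a = true) {u1 u2 u : ℝ} (h1 : u1 ≤ u) (h2 : u ≤ u2) :
    min (a.G u1) (a.G u2) ≤ a.G u := by
  rcases le_total u (a.σ : ℝ) with hs | hs
  · refine (min_le_left _ _).trans (G_le_of_abs_le C ha ?_)
    rw [abs_of_nonpos (by linarith), abs_of_nonpos (by linarith)]; linarith
  · refine (min_le_right _ _).trans (G_le_of_abs_le C ha ?_)
    rw [abs_of_nonneg (by linarith), abs_of_nonneg (by linarith)]; linarith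

/-- On `[u₁, u₂]` not containing `σ`, `G ≤ max (G u₁) (G u₂)`. [folklore] -/
theorem G_le_max {a : KAtom} (ha : atomOK C a = true) {u1 u2 u : ℝ} (h1 : u1 ≤ u) (h2 : u ≤ u2)
    (hσ : ¬((u1 ≤ (a.σ : ℝ)) ∧ ((a.σ : ℝ) ≤ u2))) : a.G u ≤ max (a.G u1) (a.G u2) := by
  rcases not_and_or.1 hσ with hs | hs
  · rw [not_le] at hs
    refine le_trans (G_le_of_abs_le C ha ?_) (le_max_left _ _)
    rw [abs_of_nonneg (by linarith), abs_of_nonneg (by linarith)]; linarith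
  · rw [not_le] at hs
    refine le_trans (G_le_of_abs_le C ha ?_) (le_max_right _ _)
    rw [abs_of_nonpos (by linarith), abs_of_nonpos (by linarith)]; linarith

/-! ### `kRange` -/

/-- **`(u - σ)/(2τ) ∈ kRange`** for `u ∈ [u₁, u₂]`. [folklore] -/
theorem kRange_spec {a : KAtom} (ha : atomOK C a = true) {u1 u2 : ℚ} {u : ℝ} (h1 : (u1 : ℝ) ≤ u) (h2 : u ≤ (u2 : ℝ)) :
    (((kRange a u1 u2).1 : ℚ) : ℝ) ≤ (u - a.σ) / (2 * a.tau) ∧ (u - a.σ) / (2 * a.tau) ≤ (((kRange a u1 u2).2 : ℚ) : ℝ) := by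
  have hτ := tau_pos C ha
  obtain ⟨_, _, _, htlo, htloτ, hτthi, _⟩ := atomOK_sound C ha
  have htlo0 : (0 : ℝ) < a.tlo := by exact_mod_cast htlo
  have hthi0 : (0 : ℝ) < a.thi := htlo0.trans_le (htloτ.trans hτthi)
  unfold kRange
  dsimp only
  constructor
  · -- lower end from `n1 = u1 - σ ≤ u - σ`
    have hn : ((u1 : ℝ) - a.σ) ≤ u - a.σ := by linarith
    split_ifs with hs
    · have hs' : (0 : ℝ) ≤ (u1 : ℝ) - a.σ := by exact_mod_cast hs
      push_cast
      calc ((u1 : ℝ) - a.σ) / (2 * a.thi) ≤ ((u1 : ℝ) - a.σ) / (2 * a.tau) :=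
            div_le_div_of_nonneg_left hs' (by positivity) (by linarith)
        _ ≤ (u - a.σ) / (2 * a.tau) := div_le_div_of_nonneg_right hn (by positivity)
    · rw [not_le] at hs
      have hs' : (u1 : ℝ) - a.σ < 0 := by exact_mod_cast hs
      push_cast
      calc ((u1 : ℝ) - a.σ) / (2 * a.tlo) ≤ ((u1 : ℝ) - a.σ) / (2 * a.tau) := by
            rw [div_le_div_iff₀ (by positivity) (by positivity)]; nlinarith
        _ ≤ (u - a.σ) / (2 * a.tau) := div_le_div_of_nonneg_right hn (by positivity)
  · have hn : u - a.σ ≤ (u2 : ℝ) - a.σ := by linarith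
    split_ifs with hs
    · have hs' : (0 : ℝ) ≤ (u2 : ℝ) - a.σ := by exact_mod_cast hs
      push_cast
      calc (u - a.σ) / (2 * a.tau) ≤ ((u2 : ℝ) - a.σ) / (2 * a.tau) := div_le_div_of_nonneg_right hn (by positivity)
        _ ≤ ((u2 : ℝ) - a.σ) / (2 * a.tlo) := div_le_div_of_nonneg_left hs' (by positivity) (by linarith)
    · rw [not_le] at hs
      have hs' : (u2 : ℝ) - a.σ < 0 := by exact_mod_cast hs
      push_cast
      calc (u - a.σ) / (2 * a.tau) ≤ ((u2 : ℝ) - a.σ) / (2 * a.tau) := div_le_div_of_nonneg_right hn (by positivity)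
        _ ≤ ((u2 : ℝ) - a.σ) / (2 * a.thi) := by
            rw [div_le_div_iff₀ (by positivity) (by positivity)]; nlinarith

/-! ### Folds over table slices -/

/-- A `foldl min` is below every element and below its start. [folklore] -/
theorem foldl_min_le {α : Type*} (f : α → ℤ) (l : List α) (z : ℤ) :
    l.foldl (fun m e => min m (f e)) z ≤ z ∧ ∀ e ∈ l, l.foldl (fun m e => min m (f e)) z ≤ f e := by
  induction l generalizing z with
  | nil => simp
  | cons x l ih =>
    simp only [List.foldl_cons, List.mem_cons, forall_eq_or_imp]
    have h := ih (min z (f x))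
    exact ⟨h.1.trans (min_le_left _ _), h.1.trans (min_le_right _ _), h.2⟩

/-- A `foldl min` from a nonnegative start over nonnegative values is nonnegative. [folklore] -/
theorem foldl_min_nonneg {α : Type*} (f : α → ℤ) (l : List α) {z : ℤ} (hz : 0 ≤ z) (hl : ∀ e ∈ l, 0 ≤ f e) :
    0 ≤ l.foldl (fun m e => min m (f e)) z := by
  induction l generalizing z with
  | nil => simpa using hz
  | cons x l ih =>
    simp only [List.foldl_cons]
    exact ih (le_min hz (hl x (List.mem_cons_self ..))) fun e he => hl e (List.mem_cons_of_mem _ he)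

/-- A `foldl max` from `0` is above every element and nonnegative. [folklore] -/
theorem le_foldl_max {α : Type*} (f : α → ℤ) (l : List α) (z : ℤ) :
    z ≤ l.foldl (fun m e => max m (f e)) z ∧ ∀ e ∈ l, f e ≤ l.foldl (fun m e => max m (f e)) z := by
  induction l generalizing z with
  | nil => simp
  | cons x l ih =>
    simp only [List.foldl_cons, List.mem_cons, forall_eq_or_imp]
    have h := ih (max z (f x))
    exact ⟨(le_max_left _ _).trans h.1, (le_max_right _ _).trans h.1, h.2⟩

/-- The element `tab[i]` belongs to the slice `(tab.drop ia).take k` when `ia ≤ i < ia + k`. [folklore] -/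
theorem getD_mem_slice (tab : List TabE) {ia k i : ℕ} (h1 : ia ≤ i) (h2 : i < ia + k) (h3 : i < tab.length) :
    tab.getD i tabD ∈ (tab.drop ia).take k := by
  rw [List.getD_eq_getElem _ _ h3]
  have hlen : i - ia < ((tab.drop ia).take k).length := by
    simp only [List.length_take, List.length_drop]; omega
  have : ((tab.drop ia).take k)[i - ia] = tab[i] := by
    rw [List.getElem_take, List.getElem_drop]; congr 1; omega
  rw [← this]
  exact List.getElem_mem hlen

/-- `minCelloS ≤ zlo64 cello_i` for `ia ≤ i < ib`. [folklore] -/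
theorem minCelloS_le (tab : List TabE) {ia ib i : ℕ} (z : ℤ) (h1 : ia ≤ i) (h2 : i < ib) (h3 : i < tab.length) :
    minCelloS tab ia ib z ≤ zlo64 (tab.getD i tabD).cello := by
  unfold minCelloS
  exact (foldl_min_le (fun e => zlo64 e.cello) _ z).2 _ (getD_mem_slice tab (k := ib - ia) h1 (by omega) h3)

/-- `zhi64 expf_i ≤ maxExpfS` for `ia ≤ i ≤ ib`, and `0 ≤ maxExpfS`. [folklore] -/
theorem le_maxExpfS (tab : List TabE) {ia ib i : ℕ} (h1 : ia ≤ i) (h2 : i ≤ ib) (h3 : i < tab.length) :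
    zhi64 (tab.getD i tabD).expf ≤ maxExpfS tab ia ib ∧ 0 ≤ maxExpfS tab ia ib := by
  unfold maxExpfS
  have h := le_foldl_max (fun e => zhi64 e.expf) ((tab.drop ia).take (ib + 1 - ia)) 0
  exact ⟨h.2 _ (getD_mem_slice tab (k := ib + 1 - ia) h1 (by omega) h3), h.1⟩

end KCert

/-- Registered sub-goal marker `stub_certMid_part14` of crux stmt-SmoothPoincare4-7631 (helper file 8-a of the kernel-clean
`stub_certMid`, line killing-flux): the Gaussian factor on an interval is above its smaller end value. [folklore] -/
theorem stub_certMid_part14 : ∀ (C : KCert.KCell) (a : KCert.KAtom), KCert.atomOK C a = true →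
    ∀ u1 u2 u : ℝ, u1 ≤ u → u ≤ u2 → min (a.G u1) (a.G u2) ≤ a.G u :=
  fun C _ h _ _ _ h1 h2 => KCert.G_ge_min C h h1 h2

end Summit.SmoothPoincare4.SmoothPoincare4.Cruxes.CylinderRungTwo.KillingFlux

end
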